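import Literature.AlgebraicGeometry.AbelianSchemes.AbelianSchemeDualTransportDualIsogeny
import Literature.AlgebraicGeometry.AbelianSchemes.AbelianSchemeDualTransportNoetherian
import Literature.AlgebraicGeometry.AbelianSchemes.DescendedHomBaseChangeComp
import Literature.AlgebraicGeometry.AbelianSchemes.PolarizationUnitHypothesis
import HarnessLib

/-!
# A fibre isomorphism of the ITERATED pulled-back tuples, exact on `λ` (dual-homomorphism form), on the `𝒪`-action and on the
# level sections, IS an isomorphism of MFK triples between the SINGLE pull-backs («TUPLE-ISO OF FIBRE ISO»)

Topic `AlgebraicGeometry/AbelianSchemes`; namespace `Literature.AlgebraicGeometry.AbelianSchemes.AbelianSchemeOver(.DualPair)`.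
THEOREMS ONLY (no def, no instance, no notation, no named fact, no `sorry`).  Cell hodgecm-mathlib (D-0151), P6 «MOD programme»,
sub-desk P6a, brick (T) of the `stub_HFROB` junction, part 2∕3 (A-p03 (g30), 2026-09-01): the moduli datum՚s injectivity field `inj₀` eats
`tupleIsoAt (spPt x̄₁) (spPt x̄₂) univ act dual pol lvl` — an isomorphism of [MumfordFogartyKirwan1994] Def. 7.2 triples between
the pull-backs of the universal tuple along `x̄ᵢ ≫ pr₁`, with `𝒪`-equivariance — while the Frobenius ∕ roof computation (σ1∕σ2
hands) delivers an isomorphism of the ITERATED pull-backs `(univ ×_𝓨 𝓨_s) ×_{𝓨_s} x̄ᵢ` exact on `λ` in the form `f ≫ λ″ ≫ f^∨ = λ′`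
(★ `dualIsogenyOver`), on `ι` and on the level points.  This file turns the latter into the former.  HC_CM is proved only modulo
the printed citations until rung 0 closes; nothing here is about HC.

THE MATHEMATICS ([MumfordFogartyKirwan1994] Ch. 7 §2 Def. 7.2–7.3: `𝒜_{g,d,n}(S)` = triples «up to isomorphism», pull-back
«in the obvious way»; [MilneAV2008] I §8: the dual is unique up to unique isomorphism; [MumfordAV1970] §15 Thm. 1: `f ↦ f^∨` is
functorial; [GortzWedhorn2020] (4.7): `X ×_S T ≅ (X ×_S S′) ×_{S′} T`).
* (part 1∕3, ★ `AbelianSchemeDualTransportDualIsogeny`) `Ĥ_e = (e⁻¹)^∨`: the dual transport of an isomorphism is the dual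
  homomorphism of its inverse, hence the `λ`-CLAUSE `λ′ ≫ Ĥ_e = e ≫ λ` from `e ≫ λ ≫ e^∨ = λ′`.
* §2 LAYER A `isoOfTriples_id_of_iso`: an isomorphism of `T`-group schemes exact on `λ` (dual-homomorphism form), on the level
  sections and on endomorphism families is an isomorphism of triples along `𝟙 T` with `Ĝ := Ĥ_e` — level∕`X`, `X̂`, Poincaré, `λ`, `ι`.
* §3 five-clause relations compose (`tupleRel_trans`, `tupleRel_comp_id_id`).
* §4 the comparison `(E, Ê) : 𝒜 ×_Y T ≅ (𝒜 ×_Y Y₀) ×_{Y₀} T` (★ `baseChangeCompGrpIso`) is a five-clause relation along `𝟙 T` in both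
  directions (`tupleRel_baseChangeCompGrpIso_hom∕inv`; naturality `baseChangeCompGrpIso_hom_naturality`).
* §5 HEAD **`exists_tupleRel_baseChange_comp_of_iso`**: `G := E₁ ≫ e ≫ E₂⁻¹`, `Ĝ := Ê₁ ≫ Ĥ_e ≫ Ê₂⁻¹` — the conclusion is VERBATIM
  the body of the P6a `tupleIsoAt (x₁ ≫ π) (x₂ ≫ π) 𝒜 ρ D pol lvl`.  (Opposite orientation and the level clause in POINT currency:
  part 3∕3 `TupleIsoAtOfFibreIsoPoints`.)

## References
* [MumfordFogartyKirwan1994] D. Mumford, J. Fogarty, F. Kirwan, *Geometric Invariant Theory*, 3rd ed. (1994), Ch. 7 §2 Def. 7.2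
  (p. 129), Def. 7.3 (p. 130); Ch. 6 §1 Cor. 6.4 (p. 117).
* [MilneAV2008] J. S. Milne, *Abelian Varieties* (2008), I §8 pp. 36–37, I §9 Thm. 9.1 (p. 42).
* [MumfordAV1970] D. Mumford, *Abelian Varieties* (1970), §15 Thm. 1 (p. 143).
* [GortzWedhorn2020] U. Görtz, T. Wedhorn, *Algebraic Geometry I*, 2nd ed. (2020), Section (4.7) (pp. 107–108), Prop. 4.16 (p. 101).
-/

set_option autoImplicit false

noncomputable section

universe u

open CategoryTheory CategoryTheory.Limits AlgebraicGeometry MonoidalCategory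
open scoped MonObj

namespace Literature.AlgebraicGeometry.AbelianSchemes

namespace AbelianSchemeOver


/-! ### §2 An isomorphism of group schemes, exact on `λ` in dual-homomorphism form and on the level sections, is an
isomorphism of MFK triples along `𝟙 T` — with the dual transport `Ĥ_e` on the hats (Layer A) -/

section LayerA

variable {T : Scheme.{u}} [IsReduced T] [IsLocallyNoetherian T] [PreconnectedSpace T]
  {A₁ A₂ : AbelianSchemeOver T} (D₁ : A₁.DualPair) (D₂ : A₂.DualPair)
  (lam₁ : A₁.X ⟶ D₁.hat.X) (lam₂ : A₂.X ⟶ D₂.hat.X) [IsMonHom lam₂]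
  (hD₁ : Nonempty ((Scheme.Modules.pullback (DualPair.unitHatSlice D₁)).obj D₁.P ≅ SheafOfModules.unit _))
  (hD₂ : Nonempty ((Scheme.Modules.pullback (DualPair.unitHatSlice D₂)).obj D₂.P ≅ SheafOfModules.unit _))
  {g n : ℕ} (φ₁ : A₁.LevelStructure g n) (φ₂ : A₂.LevelStructure g n)
  {O : Type*} (act₁ : O → (A₁.X ⟶ A₁.X)) (act₂ : O → (A₂.X ⟶ A₂.X))
  (e : A₁.X ≅ A₂.X) [IsMonHom e.hom]

include hD₁ hD₂ in
/-- **LAYER A — AN ISOMORPHISM EXACT ON `λ`, LEVEL AND ENDOMORPHISMS IS AN ISOMORPHISM OF TRIPLES ALONG `𝟙 T`.**  Over a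
reduced, connected, locally Noetherian base `T`: for abelian schemes `A₁, A₂` with dual pairs `Dᵢ` (normalised along
`Aᵢ × {ε}`: `hDᵢ`, automatic for polarised ones ★ `Polarization.nonempty_unitHatSlice_iso`), homomorphisms `λᵢ : Aᵢ → Âᵢ`,
level structures `φᵢ` and endomorphism families `ιᵢ : O → End(Aᵢ)`, an isomorphism of `T`-group schemes `e : A₁ ≅ A₂` with
(pol) `e ≫ λ₂ ≫ e^∨ = λ₁` (EXACT, ★ `dualIsogenyOver`), (lvl) `σ₁ᵢ ≫ e = σ₂ᵢ` and (act) `act₁(a) ≫ e = e ≫ act₂(a)` yields, with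
`G := e` and `Ĝ := Ĥ_e` the dual transport (★ `hatTransport`), ALL clauses of [MumfordFogartyKirwan1994] Def. 7.2's
isomorphism of triples along `𝟙 T` — level ∕ `X` (★ `levelStructure_isBaseChangeVia_id_of_isMonHom`), `X̂` (★
`hat_isBaseChangeVia_id_hatTransport_of_isLocallyNoetherian`), Poincaré `(e × Ĥ_e)^*𝒫₂ ≅ 𝒫₁` (★
`nonempty_pullback_map_hatTransport_iso`), `λ₁ ≫ Ĥ_e = e ≫ λ₂` (part 1) — plus `𝒪`-equivariance.
[cite: MumfordFogartyKirwan1994, Ch. 7 §2 Definition 7.2 (p. 129) and Definition 7.3 (p. 130)] [cite: MilneAV2008, I §8 pp. 36–37] -/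
theorem isoOfTriples_id_of_iso (hlam : e.hom ≫ lam₂ ≫ DualPair.dualIsogenyOver e.hom D₁ D₂ = lam₁)
    (hσ : ∀ i, φ₁.σ i ≫ e.hom = φ₂.σ i) (hact : ∀ a, act₁ a ≫ e.hom = e.hom ≫ act₂ a) :
    φ₁.IsBaseChangeVia φ₂ (𝟙 T) e.hom.left ∧
    D₁.hat.IsBaseChangeVia D₂.hat (𝟙 T) (DualPair.hatTransport D₂ D₁ e) ∧
    (∃ (wG : A₁.X.hom ≫ 𝟙 T = e.hom.left ≫ A₂.X.hom) (wĜ : D₁.hat.X.hom ≫ 𝟙 T = DualPair.hatTransport D₂ D₁ e ≫ D₂.hat.X.hom),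
      Nonempty ((Scheme.Modules.pullback
        (pullback.map A₁.X.hom D₁.hat.X.hom A₂.X.hom D₂.hat.X.hom e.hom.left (DualPair.hatTransport D₂ D₁ e) (𝟙 T) wG wĜ)).obj
          D₂.P ≅ D₁.P)) ∧
    lam₁.left ≫ DualPair.hatTransport D₂ D₁ e = e.hom.left ≫ lam₂.left ∧
    ∀ a : O, (act₁ a).left ≫ e.hom.left = e.hom.left ≫ (act₂ a).left := by
  haveI : IsMonHom e.symm.hom := (inferInstance : IsMonHom e.inv)
  refine ⟨levelStructure_isBaseChangeVia_id_of_isMonHom φ₁ φ₂ e.hom hσ,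
    DualPair.hat_isBaseChangeVia_id_hatTransport_of_isLocallyNoetherian D₂ D₁ e e.symm rfl hD₂ hD₁,
    ⟨by rw [Category.comp_id, Over.w e.hom], by rw [Category.comp_id, DualPair.hatTransport_comp_hom],
      DualPair.nonempty_pullback_map_hatTransport_iso D₂ D₁ e⟩,
    DualPair.lam_left_comp_hatTransport_of_comp_dualIsogenyOver_eq D₂ D₁ e hD₂ lam₂ lam₁ hlam, fun a => ?_⟩
  rw [← Over.comp_left, ← Over.comp_left, hact]

end LayerA

/-! ### §3 Relations of tuples (level ∕ `X`, `X̂`, Poincaré, `λ`, endomorphisms) compose ([MFK94] Def. 7.2 «contravariant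
functor … in the obvious way», for the unpackaged five-clause relation) -/

section Trans

variable {S S' S'' : Scheme.{u}} {A'' : AbelianSchemeOver S''} {A' : AbelianSchemeOver S'} {A : AbelianSchemeOver S}
  {D'' : A''.DualPair} {D' : A'.DualPair} {D : A.DualPair}
  {lam'' : A''.X ⟶ D''.hat.X} {lam' : A'.X ⟶ D'.hat.X} {lam : A.X ⟶ D.hat.X}
  {g n : ℕ} {φ'' : A''.LevelStructure g n} {φ' : A'.LevelStructure g n} {φ : A.LevelStructure g n}
  {O : Type*} {act'' : O → (A''.X ⟶ A''.X)} {act' : O → (A'.X ⟶ A'.X)} {act : O → (A.X ⟶ A.X)}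
  {f' : S'' ⟶ S'} {f : S' ⟶ S} {G' : A''.X.left ⟶ A'.X.left} {Ĝ' : D''.hat.X.left ⟶ D'.hat.X.left}
  {G : A'.X.left ⟶ A.X.left} {Ĝ : D'.hat.X.left ⟶ D.hat.X.left}

/-- **Five-clause relations of tuples COMPOSE** along `S'' → S' → S`: level ∕ `X` by ★ `LevelStructure.IsBaseChangeVia.trans`,
`X̂` by ★ `AbelianSchemeOver.IsBaseChangeVia.trans`, Poincaré by `pullback.map_comp` + `Scheme.Modules.pullbackComp`, `λ` and
endomorphisms by reassociation (the proof of ★ `PolarizedAbelianSchemeWithLevel.IsBaseChangeVia.trans`, unpackaged and with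
the `𝒪`-clause). [cite: MumfordFogartyKirwan1994, Ch. 7 §2 Definition 7.2 (p. 129)] [cite: GortzWedhorn2020, Section (4.7) (pp. 107–108)] -/
theorem tupleRel_trans
    (h' : φ''.IsBaseChangeVia φ' f' G' ∧ D''.hat.IsBaseChangeVia D'.hat f' Ĝ' ∧
      (∃ (wG : A''.X.hom ≫ f' = G' ≫ A'.X.hom) (wĜ : D''.hat.X.hom ≫ f' = Ĝ' ≫ D'.hat.X.hom),
        Nonempty ((Scheme.Modules.pullback
          (pullback.map A''.X.hom D''.hat.X.hom A'.X.hom D'.hat.X.hom G' Ĝ' f' wG wĜ)).obj D'.P ≅ D''.P)) ∧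
      lam''.left ≫ Ĝ' = G' ≫ lam'.left ∧ ∀ a : O, (act'' a).left ≫ G' = G' ≫ (act' a).left)
    (h : φ'.IsBaseChangeVia φ f G ∧ D'.hat.IsBaseChangeVia D.hat f Ĝ ∧
      (∃ (wG : A'.X.hom ≫ f = G ≫ A.X.hom) (wĜ : D'.hat.X.hom ≫ f = Ĝ ≫ D.hat.X.hom),
        Nonempty ((Scheme.Modules.pullback
          (pullback.map A'.X.hom D'.hat.X.hom A.X.hom D.hat.X.hom G Ĝ f wG wĜ)).obj D.P ≅ D'.P)) ∧
      lam'.left ≫ Ĝ = G ≫ lam.left ∧ ∀ a : O, (act' a).left ≫ G = G ≫ (act a).left) :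
    φ''.IsBaseChangeVia φ (f' ≫ f) (G' ≫ G) ∧ D''.hat.IsBaseChangeVia D.hat (f' ≫ f) (Ĝ' ≫ Ĝ) ∧
      (∃ (wG : A''.X.hom ≫ f' ≫ f = (G' ≫ G) ≫ A.X.hom) (wĜ : D''.hat.X.hom ≫ f' ≫ f = (Ĝ' ≫ Ĝ) ≫ D.hat.X.hom),
        Nonempty ((Scheme.Modules.pullback
          (pullback.map A''.X.hom D''.hat.X.hom A.X.hom D.hat.X.hom (G' ≫ G) (Ĝ' ≫ Ĝ) (f' ≫ f) wG wĜ)).obj D.P ≅ D''.P)) ∧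
      lam''.left ≫ (Ĝ' ≫ Ĝ) = (G' ≫ G) ≫ lam.left ∧ ∀ a : O, (act'' a).left ≫ (G' ≫ G) = (G' ≫ G) ≫ (act a).left := by
  obtain ⟨hl', hh', ⟨wG', wĜ', ⟨e'⟩⟩, hlam', hact'⟩ := h'
  obtain ⟨hl, hh, ⟨wG, wĜ, ⟨e⟩⟩, hlam, hact⟩ := h
  have wG'' : A''.X.hom ≫ f' ≫ f = (G' ≫ G) ≫ A.X.hom := by rw [reassoc_of% wG', wG, Category.assoc]
  have wĜ'' : D''.hat.X.hom ≫ f' ≫ f = (Ĝ' ≫ Ĝ) ≫ D.hat.X.hom := by rw [reassoc_of% wĜ', wĜ, Category.assoc]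
  refine ⟨hl'.trans hl, hh'.trans hh, ⟨wG'', wĜ'', ⟨?_⟩⟩, ?_, fun a => ?_⟩
  · have hcomp : pullback.map A''.X.hom D''.hat.X.hom A.X.hom D.hat.X.hom (G' ≫ G) (Ĝ' ≫ Ĝ) (f' ≫ f) wG'' wĜ'' =
        pullback.map A''.X.hom D''.hat.X.hom A'.X.hom D'.hat.X.hom G' Ĝ' f' wG' wĜ' ≫
          pullback.map A'.X.hom D'.hat.X.hom A.X.hom D.hat.X.hom G Ĝ f wG wĜ :=
      (pullback.map_comp G' G Ĝ' Ĝ f' f wG' wĜ' wG wĜ).symm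
    exact (Scheme.Modules.pullbackCongr hcomp).app D.P ≪≫ ((Scheme.Modules.pullbackComp _ _).app D.P).symm ≪≫
      (Scheme.Modules.pullback _).mapIso e ≪≫ e'
  · rw [reassoc_of% hlam', hlam, Category.assoc]
  · rw [reassoc_of% (hact' a), hact a, Category.assoc]

/-- **Composition along `𝟙 T`** (`𝟙 ≫ 𝟙 = 𝟙`): two five-clause relations along `𝟙 T` compose to one along `𝟙 T` — the
form in which ★ `tupleIsoAt`-shaped conclusions chain. [cite: MumfordFogartyKirwan1994, Ch. 7 §2 Definition 7.2 (p. 129)] -/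
theorem tupleRel_comp_id_id {T : Scheme.{u}} {A₁ A₂ A₃ : AbelianSchemeOver T}
    {D₁ : A₁.DualPair} {D₂ : A₂.DualPair} {D₃ : A₃.DualPair}
    {lam₁ : A₁.X ⟶ D₁.hat.X} {lam₂ : A₂.X ⟶ D₂.hat.X} {lam₃ : A₃.X ⟶ D₃.hat.X}
    {φ₁ : A₁.LevelStructure g n} {φ₂ : A₂.LevelStructure g n} {φ₃ : A₃.LevelStructure g n}
    {act₁ : O → (A₁.X ⟶ A₁.X)} {act₂ : O → (A₂.X ⟶ A₂.X)} {act₃ : O → (A₃.X ⟶ A₃.X)}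
    {G₁ : A₁.X.left ⟶ A₂.X.left} {Ĝ₁ : D₁.hat.X.left ⟶ D₂.hat.X.left}
    {G₂ : A₂.X.left ⟶ A₃.X.left} {Ĝ₂ : D₂.hat.X.left ⟶ D₃.hat.X.left}
    (h₁ : φ₁.IsBaseChangeVia φ₂ (𝟙 T) G₁ ∧ D₁.hat.IsBaseChangeVia D₂.hat (𝟙 T) Ĝ₁ ∧
      (∃ (wG : A₁.X.hom ≫ 𝟙 T = G₁ ≫ A₂.X.hom) (wĜ : D₁.hat.X.hom ≫ 𝟙 T = Ĝ₁ ≫ D₂.hat.X.hom),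
        Nonempty ((Scheme.Modules.pullback
          (pullback.map A₁.X.hom D₁.hat.X.hom A₂.X.hom D₂.hat.X.hom G₁ Ĝ₁ (𝟙 T) wG wĜ)).obj D₂.P ≅ D₁.P)) ∧
      lam₁.left ≫ Ĝ₁ = G₁ ≫ lam₂.left ∧ ∀ a : O, (act₁ a).left ≫ G₁ = G₁ ≫ (act₂ a).left)
    (h₂ : φ₂.IsBaseChangeVia φ₃ (𝟙 T) G₂ ∧ D₂.hat.IsBaseChangeVia D₃.hat (𝟙 T) Ĝ₂ ∧
      (∃ (wG : A₂.X.hom ≫ 𝟙 T = G₂ ≫ A₃.X.hom) (wĜ : D₂.hat.X.hom ≫ 𝟙 T = Ĝ₂ ≫ D₃.hat.X.hom),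
        Nonempty ((Scheme.Modules.pullback
          (pullback.map A₂.X.hom D₂.hat.X.hom A₃.X.hom D₃.hat.X.hom G₂ Ĝ₂ (𝟙 T) wG wĜ)).obj D₃.P ≅ D₂.P)) ∧
      lam₂.left ≫ Ĝ₂ = G₂ ≫ lam₃.left ∧ ∀ a : O, (act₂ a).left ≫ G₂ = G₂ ≫ (act₃ a).left) :
    φ₁.IsBaseChangeVia φ₃ (𝟙 T) (G₁ ≫ G₂) ∧ D₁.hat.IsBaseChangeVia D₃.hat (𝟙 T) (Ĝ₁ ≫ Ĝ₂) ∧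
      (∃ (wG : A₁.X.hom ≫ 𝟙 T = (G₁ ≫ G₂) ≫ A₃.X.hom) (wĜ : D₁.hat.X.hom ≫ 𝟙 T = (Ĝ₁ ≫ Ĝ₂) ≫ D₃.hat.X.hom),
        Nonempty ((Scheme.Modules.pullback
          (pullback.map A₁.X.hom D₁.hat.X.hom A₃.X.hom D₃.hat.X.hom (G₁ ≫ G₂) (Ĝ₁ ≫ Ĝ₂) (𝟙 T) wG wĜ)).obj D₃.P ≅ D₁.P)) ∧
      lam₁.left ≫ (Ĝ₁ ≫ Ĝ₂) = (G₁ ≫ G₂) ≫ lam₃.left ∧ ∀ a : O, (act₁ a).left ≫ (G₁ ≫ G₂) = (G₁ ≫ G₂) ≫ (act₃ a).left := by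
  have h := tupleRel_trans h₁ h₂
  rwa [Category.comp_id] at h

end Trans

/-! ### §4 The comparison `A ×_Y T ≅ (A ×_Y Y₀) ×_{Y₀} T` (★ `baseChangeCompGrpIso`) is a five-clause relation along `𝟙 T`,
in both directions -/

section Comparison

variable {Y Y₀ T : Scheme.{u}} (𝒜 : AbelianSchemeOver Y) {ℬ : AbelianSchemeOver Y}
  {O : Type*} [CommRing O] (ρ : RingAction O 𝒜) (D : 𝒜.DualPair) (pol : 𝒜.Polarization D)
  {g n : ℕ} (lvl : 𝒜.LevelStructure g n) (π : Y₀ ⟶ Y) (x : T ⟶ Y₀)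

/-- **Naturality of the comparison isomorphism** in the abelian scheme: for `φ : A → B` over `Y`,
`φ ×_Y T ≫ E_B = E_A ≫ (φ ×_Y Y₀) ×_{Y₀} T` (Mathlib `Over.pullbackComp` is a natural isomorphism; ★
`baseChangeCompGrpIso_hom_hom_hom`). [cite: GortzWedhorn2020, Section (4.7) (pp. 107–108)] -/
theorem baseChangeCompGrpIso_hom_naturality (φ : 𝒜.X ⟶ ℬ.X) :
    (Over.pullback (x ≫ π)).map φ ≫ (ℬ.baseChangeCompGrpIso π x).hom.hom.hom =
      (𝒜.baseChangeCompGrpIso π x).hom.hom.hom ≫ (Over.pullback x).map ((Over.pullback π).map φ) := by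
  rw [baseChangeCompGrpIso_hom_hom_hom, baseChangeCompGrpIso_hom_hom_hom]
  exact (Over.pullbackComp x π).hom.naturality φ

/-- Naturality of the inverse comparison: `(φ ×_Y Y₀) ×_{Y₀} T ≫ E_B⁻¹ = E_A⁻¹ ≫ φ ×_Y T`. [cite: GortzWedhorn2020, Section (4.7) (pp. 107–108)] -/
theorem baseChangeCompGrpIso_inv_naturality (φ : 𝒜.X ⟶ ℬ.X) :
    (Over.pullback x).map ((Over.pullback π).map φ) ≫ (ℬ.baseChangeCompGrpIso π x).inv.hom.hom =
      (𝒜.baseChangeCompGrpIso π x).inv.hom.hom ≫ (Over.pullback (x ≫ π)).map φ := by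
  rw [baseChangeCompGrpIso_inv_hom_hom, baseChangeCompGrpIso_inv_hom_hom]
  exact (Over.pullbackComp x π).inv.naturality φ

/-- **The comparison `(E, Ê) : 𝒜 ×_Y T → (𝒜 ×_Y Y₀) ×_{Y₀} T` IS A FIVE-CLAUSE RELATION ALONG `𝟙 T`** for the pulled-back
tuples `(𝒜, ι, Â, 𝒫, λ, lvl)`: level ∕ `X` (★ `sectionBaseChange_comp_baseChangeCompGrpIso_hom`, ★
`levelStructure_isBaseChangeVia_id_of_isMonHom`), `X̂` (★ `baseChange_comp_isBaseChangeVia_id` for `Â`), Poincaré (★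
`DualPair.nonempty_pullback_map_hom_P_iso`), `λ` and `ι` (naturality). [cite: MumfordFogartyKirwan1994, Ch. 7 §2 Definition 7.2 (p. 129)]
[cite: GortzWedhorn2020, Section (4.7) (pp. 107–108)] -/
theorem tupleRel_baseChangeCompGrpIso_hom :
    (lvl.baseChange (x ≫ π)).IsBaseChangeVia ((lvl.baseChange π).baseChange x) (𝟙 T)
        (𝒜.baseChangeCompGrpIso π x).hom.hom.hom.left ∧
      (D.baseChange (x ≫ π)).hat.IsBaseChangeVia ((D.baseChange π).baseChange x).hat (𝟙 T)
        (D.hat.baseChangeCompGrpIso π x).hom.hom.hom.left ∧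
      (∃ (wG : (𝒜.baseChange (x ≫ π)).X.hom ≫ 𝟙 T =
            (𝒜.baseChangeCompGrpIso π x).hom.hom.hom.left ≫ ((𝒜.baseChange π).baseChange x).X.hom)
          (wĜ : (D.baseChange (x ≫ π)).hat.X.hom ≫ 𝟙 T =
            (D.hat.baseChangeCompGrpIso π x).hom.hom.hom.left ≫ ((D.baseChange π).baseChange x).hat.X.hom),
        Nonempty ((Scheme.Modules.pullback
          (pullback.map (𝒜.baseChange (x ≫ π)).X.hom (D.baseChange (x ≫ π)).hat.X.hom ((𝒜.baseChange π).baseChange x).X.hom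
            ((D.baseChange π).baseChange x).hat.X.hom (𝒜.baseChangeCompGrpIso π x).hom.hom.hom.left
            (D.hat.baseChangeCompGrpIso π x).hom.hom.hom.left (𝟙 T) wG wĜ)).obj ((D.baseChange π).baseChange x).P ≅
          (D.baseChange (x ≫ π)).P)) ∧
      (pol.baseChange (x ≫ π)).lam.left ≫ (D.hat.baseChangeCompGrpIso π x).hom.hom.hom.left =
        (𝒜.baseChangeCompGrpIso π x).hom.hom.hom.left ≫ ((pol.baseChange π).baseChange x).lam.left ∧
      ∀ a : O, (baseChangeHom (ρ.i a) (x ≫ π)).left ≫ (𝒜.baseChangeCompGrpIso π x).hom.hom.hom.left =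
        (𝒜.baseChangeCompGrpIso π x).hom.hom.hom.left ≫ (baseChangeHom (baseChangeHom (ρ.i a) π) x).left := by
  haveI := 𝒜.isIso_baseChangeCompGrpIso_hom_hom_hom π x
  have wH : (𝒜.baseChange (x ≫ π)).X.hom ≫ 𝟙 T =
      (𝒜.baseChangeCompGrpIso π x).hom.hom.hom.left ≫ ((𝒜.baseChange π).baseChange x).X.hom := by
    rw [Category.comp_id, Over.w]
  have wĤ : (D.baseChange (x ≫ π)).hat.X.hom ≫ 𝟙 T =
      (D.hat.baseChangeCompGrpIso π x).hom.hom.hom.left ≫ ((D.baseChange π).baseChange x).hat.X.hom := by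
    rw [Category.comp_id]
    exact (Over.w (D.hat.baseChangeCompGrpIso π x).hom.hom.hom).symm
  refine ⟨levelStructure_isBaseChangeVia_id_of_isMonHom _ _ (𝒜.baseChangeCompGrpIso π x).hom.hom.hom
      (fun i => 𝒜.sectionBaseChange_comp_baseChangeCompGrpIso_hom π x (lvl.σ i)),
    D.hat.baseChange_comp_isBaseChangeVia_id π x, ⟨wH, wĤ, DualPair.nonempty_pullback_map_hom_P_iso 𝒜 D π x wH wĤ⟩, ?_,
    fun a => ?_⟩
  · haveI := pol.isMonHom
    rw [← Over.comp_left, ← Over.comp_left]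
    exact congrArg CommaMorphism.left (baseChangeCompGrpIso_hom_naturality 𝒜 π x pol.lam)
  · rw [← Over.comp_left, ← Over.comp_left]
    exact congrArg CommaMorphism.left (baseChangeCompGrpIso_hom_naturality 𝒜 π x (ρ.i a))

/-- **The inverse comparison `(E⁻¹, Ê⁻¹) : (𝒜 ×_Y Y₀) ×_{Y₀} T → 𝒜 ×_Y T` IS A FIVE-CLAUSE RELATION ALONG `𝟙 T`** (★
`sectionBaseChange_sectionBaseChange_comp_baseChangeCompGrpIso_inv`, ★ `baseChange_baseChange_isBaseChangeVia_id`, ★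
`DualPair.nonempty_pullback_map_inv_P_iso`, naturality). [cite: MumfordFogartyKirwan1994, Ch. 7 §2 Definition 7.2 (p. 129)]
[cite: GortzWedhorn2020, Section (4.7) (pp. 107–108)] -/
theorem tupleRel_baseChangeCompGrpIso_inv :
    ((lvl.baseChange π).baseChange x).IsBaseChangeVia (lvl.baseChange (x ≫ π)) (𝟙 T)
        (𝒜.baseChangeCompGrpIso π x).inv.hom.hom.left ∧
      ((D.baseChange π).baseChange x).hat.IsBaseChangeVia (D.baseChange (x ≫ π)).hat (𝟙 T)
        (D.hat.baseChangeCompGrpIso π x).inv.hom.hom.left ∧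
      (∃ (wG : ((𝒜.baseChange π).baseChange x).X.hom ≫ 𝟙 T =
            (𝒜.baseChangeCompGrpIso π x).inv.hom.hom.left ≫ (𝒜.baseChange (x ≫ π)).X.hom)
          (wĜ : ((D.baseChange π).baseChange x).hat.X.hom ≫ 𝟙 T =
            (D.hat.baseChangeCompGrpIso π x).inv.hom.hom.left ≫ (D.baseChange (x ≫ π)).hat.X.hom),
        Nonempty ((Scheme.Modules.pullback
          (pullback.map ((𝒜.baseChange π).baseChange x).X.hom ((D.baseChange π).baseChange x).hat.X.hom
            (𝒜.baseChange (x ≫ π)).X.hom (D.baseChange (x ≫ π)).hat.X.hom (𝒜.baseChangeCompGrpIso π x).inv.hom.hom.left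
            (D.hat.baseChangeCompGrpIso π x).inv.hom.hom.left (𝟙 T) wG wĜ)).obj (D.baseChange (x ≫ π)).P ≅
          ((D.baseChange π).baseChange x).P)) ∧
      ((pol.baseChange π).baseChange x).lam.left ≫ (D.hat.baseChangeCompGrpIso π x).inv.hom.hom.left =
        (𝒜.baseChangeCompGrpIso π x).inv.hom.hom.left ≫ (pol.baseChange (x ≫ π)).lam.left ∧
      ∀ a : O, (baseChangeHom (baseChangeHom (ρ.i a) π) x).left ≫ (𝒜.baseChangeCompGrpIso π x).inv.hom.hom.left =
        (𝒜.baseChangeCompGrpIso π x).inv.hom.hom.left ≫ (baseChangeHom (ρ.i a) (x ≫ π)).left := by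
  haveI := 𝒜.isIso_baseChangeCompGrpIso_inv_hom_hom π x
  have wH : ((𝒜.baseChange π).baseChange x).X.hom ≫ 𝟙 T =
      (𝒜.baseChangeCompGrpIso π x).inv.hom.hom.left ≫ (𝒜.baseChange (x ≫ π)).X.hom := by
    rw [Category.comp_id]
    exact (Over.w (𝒜.baseChangeCompGrpIso π x).inv.hom.hom).symm
  have wĤ : ((D.baseChange π).baseChange x).hat.X.hom ≫ 𝟙 T =
      (D.hat.baseChangeCompGrpIso π x).inv.hom.hom.left ≫ (D.baseChange (x ≫ π)).hat.X.hom := by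
    rw [Category.comp_id]
    exact (Over.w (D.hat.baseChangeCompGrpIso π x).inv.hom.hom).symm
  refine ⟨levelStructure_isBaseChangeVia_id_of_isMonHom _ _ (𝒜.baseChangeCompGrpIso π x).inv.hom.hom
      (fun i => 𝒜.sectionBaseChange_sectionBaseChange_comp_baseChangeCompGrpIso_inv π x (lvl.σ i)),
    D.hat.baseChange_baseChange_isBaseChangeVia_id π x, ⟨wH, wĤ, DualPair.nonempty_pullback_map_inv_P_iso 𝒜 D π x wH wĤ⟩,
    ?_, fun a => ?_⟩
  · haveI := pol.isMonHom
    rw [← Over.comp_left, ← Over.comp_left]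
    exact congrArg CommaMorphism.left (baseChangeCompGrpIso_inv_naturality 𝒜 π x pol.lam)
  · rw [← Over.comp_left, ← Over.comp_left]
    exact congrArg CommaMorphism.left (baseChangeCompGrpIso_inv_naturality 𝒜 π x (ρ.i a))

end Comparison

/-! ### §5 THE HEAD: a fibre isomorphism of the iterated tuples, exact on `λ` ∕ `ι` ∕ level, is an isomorphism of triples
between the single pull-backs — the ★ `tupleIsoAt (x₁ ≫ π) (x₂ ≫ π) 𝒜 ρ D pol lvl` shape of the P6a moduli datum -/

section Head

variable {Y Y₀ T : Scheme.{u}} [IsReduced T] [IsLocallyNoetherian T] [PreconnectedSpace T]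
  (𝒜 : AbelianSchemeOver Y) {O : Type*} [CommRing O] (ρ : RingAction O 𝒜) (D : 𝒜.DualPair) (pol : 𝒜.Polarization D)
  {g N : ℕ} (lvl : 𝒜.LevelStructure g N) (π : Y₀ ⟶ Y) (x₁ x₂ : T ⟶ Y₀)

/-- **TUPLE-ISO OF FIBRE ISO (brick (T)).**  Let `(𝒜, ι, (Â, 𝒫), λ, lvl)` be a tuple over `Y`, `π : Y₀ → Y`, and
`x₁, x₂ : T → Y₀` two points of a reduced connected locally Noetherian `T` (e.g. `T = Spec k`).  An isomorphism of
`T`-group schemes `e : (𝒜 ×_Y Y₀) ×_{Y₀, x₁} T ≅ (𝒜 ×_Y Y₀) ×_{Y₀, x₂} T` of the ITERATED pull-backs which is (pol) EXACT on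
the polarisations in dual-homomorphism form `e ≫ λ₂ ≫ e^∨ = λ₁` (★ `dualIsogenyOver`; no similitude factor), (lvl) carries
the level sections `σ₁ᵢ ≫ e = σ₂ᵢ`, and (act) commutes with the `𝒪`-action, yields an ISOMORPHISM OF MFK TRIPLES ALONG
`𝟙 T` between the SINGLE pull-backs `𝒜 ×_{Y, x₁ ≫ π} T` and `𝒜 ×_{Y, x₂ ≫ π} T` with `𝒪`-equivariance: maps `G`, `Ĝ`
with the level ∕ `X`-clause, the `X̂`-clause, the Poincaré clause `(G × Ĝ)^*𝒫₂ ≅ 𝒫₁`, `λ₁ ≫ Ĝ = G ≫ λ₂` and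
`ι₁(a) ≫ G = G ≫ ι₂(a)` ([MumfordFogartyKirwan1994] Def. 7.2 «all up to isomorphism», [GortzWedhorn2020] (4.7) transitivity
of base change).  Proof: `G := E₁ ≫ e ≫ E₂⁻¹`, `Ĝ := Ê₁ ≫ Ĥ_e ≫ Ê₂⁻¹` (§§2–4 composed along `𝟙 T`).
[cite: MumfordFogartyKirwan1994, Ch. 7 §2 Definition 7.2 (p. 129) and Definition 7.3 (p. 130)]
[cite: GortzWedhorn2020, Section (4.7) (pp. 107–108) and Prop. 4.16 (p. 101)] [cite: MilneAV2008, I §8 pp. 36–37] -/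
theorem exists_tupleRel_baseChange_comp_of_iso
    (e : ((𝒜.baseChange π).baseChange x₁).X ≅ ((𝒜.baseChange π).baseChange x₂).X) [IsMonHom e.hom]
    (hlam : e.hom ≫ ((pol.baseChange π).baseChange x₂).lam ≫
        DualPair.dualIsogenyOver e.hom ((D.baseChange π).baseChange x₁) ((D.baseChange π).baseChange x₂) =
      ((pol.baseChange π).baseChange x₁).lam)
    (hσ : ∀ i, ((lvl.baseChange π).baseChange x₁).σ i ≫ e.hom = ((lvl.baseChange π).baseChange x₂).σ i)
    (hact : ∀ a, baseChangeHom (baseChangeHom (ρ.i a) π) x₁ ≫ e.hom = e.hom ≫ baseChangeHom (baseChangeHom (ρ.i a) π) x₂) :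
    ∃ (G : (𝒜.baseChange (x₁ ≫ π)).X.left ⟶ (𝒜.baseChange (x₂ ≫ π)).X.left)
      (Ĝ : (D.baseChange (x₁ ≫ π)).hat.X.left ⟶ (D.baseChange (x₂ ≫ π)).hat.X.left),
      (lvl.baseChange (x₁ ≫ π)).IsBaseChangeVia (lvl.baseChange (x₂ ≫ π)) (𝟙 T) G ∧
      (D.baseChange (x₁ ≫ π)).hat.IsBaseChangeVia (D.baseChange (x₂ ≫ π)).hat (𝟙 T) Ĝ ∧
      (∃ (wG : (𝒜.baseChange (x₁ ≫ π)).X.hom ≫ 𝟙 T = G ≫ (𝒜.baseChange (x₂ ≫ π)).X.hom)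
          (wĜ : (D.baseChange (x₁ ≫ π)).hat.X.hom ≫ 𝟙 T = Ĝ ≫ (D.baseChange (x₂ ≫ π)).hat.X.hom),
        Nonempty ((Scheme.Modules.pullback
          (pullback.map (𝒜.baseChange (x₁ ≫ π)).X.hom (D.baseChange (x₁ ≫ π)).hat.X.hom
            (𝒜.baseChange (x₂ ≫ π)).X.hom (D.baseChange (x₂ ≫ π)).hat.X.hom G Ĝ (𝟙 T) wG wĜ)).obj (D.baseChange (x₂ ≫ π)).P ≅
          (D.baseChange (x₁ ≫ π)).P)) ∧
      (pol.baseChange (x₁ ≫ π)).lam.left ≫ Ĝ = G ≫ (pol.baseChange (x₂ ≫ π)).lam.left ∧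
      ∀ a : O, (baseChangeHom (ρ.i a) (x₁ ≫ π)).left ≫ G = G ≫ (baseChangeHom (ρ.i a) (x₂ ≫ π)).left := by
  haveI := ((pol.baseChange π).baseChange x₂).isMonHom
  have r₁ := tupleRel_baseChangeCompGrpIso_hom 𝒜 ρ D pol lvl π x₁
  have r₂ := isoOfTriples_id_of_iso ((D.baseChange π).baseChange x₁) ((D.baseChange π).baseChange x₂)
    ((pol.baseChange π).baseChange x₁).lam ((pol.baseChange π).baseChange x₂).lam
    ((pol.baseChange π).baseChange x₁).nonempty_unitHatSlice_iso ((pol.baseChange π).baseChange x₂).nonempty_unitHatSlice_iso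
    ((lvl.baseChange π).baseChange x₁) ((lvl.baseChange π).baseChange x₂)
    (fun a => baseChangeHom (baseChangeHom (ρ.i a) π) x₁) (fun a => baseChangeHom (baseChangeHom (ρ.i a) π) x₂)
    e hlam hσ hact
  have r₃ := tupleRel_baseChangeCompGrpIso_inv 𝒜 ρ D pol lvl π x₂
  exact ⟨_, _, tupleRel_comp_id_id (tupleRel_comp_id_id r₁ r₂) r₃⟩

end Head

end AbelianSchemeOver

end Literature.AlgebraicGeometry.AbelianSchemes

end
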